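import Summits.AtomisticToContinuum.FouriersLaw.Theses.CurrentTiltQuench
import Summits.AtomisticToContinuum.FouriersLaw.Theorems.CurrentTiltQuenchBridgeGlue

/-!
# Plan skeleton (BC3 shape) for piece 2 of the r1 split of `JunctionLocality.NonBallistic`:
# `CurrentTiltQuench.NoTruncatedDrude` (stmt-AtomisticToContinuum-11030) ⟸ CTQ's PROVED BridgeGlue family

Strategist r1 (cstrat-stmt-AtomisticToContinuum-9127-r1), 2026-08-17. The open piece `NoTruncatedDrude` (stmt-11030; today a
rank-9 support of CurrentTiltQuench / NoHiddenChargesKubo with no skeleton) has a PROVED route-level decomposition on CurrentTiltQuench: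
`BridgeGlue : UniformQuadraticResponse (stmt-11026, X1) → QuenchCurrentDies (stmt-11028, X2) → BoundedOddRigidity (stmt-11027, X3) →
NoTruncatedDrude`, landed as `Theorems.CurrentTiltQuench.bridgeGlue_proof` (af828c340efd). This file records that family as a
registered-skeleton-shaped plan for the piece: three NAMED stubs = the three filed CTQ cruxes BY NAME (dedup exact), and the
kernel-checked composition `NoTruncatedDrude_of`. Sorries ONLY inside `stub_*`. The second filed family (NoHiddenChargesKubo:
GibbsClustering ∧ LocalChargeClassification ∧ ChargeCompleteness ⇒ HydroBridge ⇒ NoTruncatedDrude) is the alternative line; its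
HydroBridge (stmt-11917) is itself still open, so it is not typed here.

Hardest stub: `stub_boundedOddRigidity` (X3 = odd-sector macro-ergodicity of the infinite pinned chain; its own crux dir
`Cruxes/BoundedOddRigidity/Lines/odd_charge_split.lean` has the registered sub-skeleton with `stub_noLocalIntegrals` = stmt-12074).
`stub_uniformQuadraticResponse` (X1) carries the τ-uniform second-order response bound ("the whole anti-ballistic content" per its
own why-might-fail); `stub_quenchCurrentDies` (X2) is Krylov–Bogoliubov compactness of averaged quench states (L on paper, XL in Lean).
-/

namespace Summit.AtomisticToContinuum.FouriersLaw.Cruxes.NoTruncatedDrude.BridgeFamily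

open Summit.AtomisticToContinuum.FouriersLaw.Theses

/-- stub X1 = stmt-AtomisticToContinuum-11026 verbatim (by name). -/
theorem stub_uniformQuadraticResponse : CurrentTiltQuench.UniformQuadraticResponse := by
  sorry

/-- stub X2 = stmt-AtomisticToContinuum-11028 verbatim (by name). -/
theorem stub_quenchCurrentDies : CurrentTiltQuench.QuenchCurrentDies := by
  sorry

/-- stub X3 = stmt-AtomisticToContinuum-11027 verbatim (by name); the hardest stub (odd macro-ergodicity). -/
theorem stub_boundedOddRigidity : CurrentTiltQuench.BoundedOddRigidity := by
  sorry

/-- The composition: the piece from the three stubs, by the LANDED `bridgeGlue_proof` (no sorry here). -/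
theorem NoTruncatedDrude_of :
    CurrentTiltQuench.UniformQuadraticResponse → CurrentTiltQuench.QuenchCurrentDies →
      CurrentTiltQuench.BoundedOddRigidity → CurrentTiltQuench.NoTruncatedDrude :=
  Summit.AtomisticToContinuum.FouriersLaw.Theorems.CurrentTiltQuench.bridgeGlue_proof

/-- … hence the piece, modulo the stubs. -/
theorem noTruncatedDrude_of_stubs : CurrentTiltQuench.NoTruncatedDrude :=
  NoTruncatedDrude_of stub_uniformQuadraticResponse stub_quenchCurrentDies stub_boundedOddRigidity

end Summit.AtomisticToContinuum.FouriersLaw.Cruxes.NoTruncatedDrude.BridgeFamily
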